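import Summits.HodgeConjecture.HodgeConjecture.Theorems.CyclicUnitaryPowersK1OfPrintNumbers
import Summits.HodgeConjecture.HodgeConjecture.Theorems.CyclicUnitaryPowersPLPackageOfLocalMonodromy
import Literature.AlgebraicGeometry.HodgeTheory.CyclicReflectionSystemOfMeridianPowers
import Summits.HodgeConjecture.HodgeConjecture.Theorems.CyclicUnitaryPowersLocalMonodromyBoundReflection
import HarnessLib

/-!
# Crux K1-A from the BOUND-FORM local monodromy (`dim V ≤ p − 1`, no injectivity, no non-vanishing):
# K1 ⟸ {F1‡, PG, B2, CDK} (route `CyclicUnitaryPowers`, item stmt-HodgeConjecture-19544)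

Prover seat `hodge-nonav-prover-Ax` (g9), cell `hodge-nonav`. Landed `--supports stmt-HodgeConjecture-19544`; sorry-free,
no definition, no new named fact here. CONDITIONAL results; nothing here says HC ∕ HC_AV is proved; rung F-H1 is not moved.

Sequel of `CyclicUnitaryPowersLocalMonodromyReflection` / `…PLPackageOfLocalMonodromy` / `…K1OfPrintNumbers` (Bx). The fact F1†
`carlsonToledo1999_nodalMeridianLocalMonodromy` asserts `dim V = p − 1` for the vanishing space `V` of a nodal
meridian; its discharge would need the INJECTIVITY of the vanishing homology of the `A_{p−1}` Milnor fibre in `H²` of the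
nearby fibre (definiteness of the `A_{p−1}` form and its compatibility with the cup product — infrastructure the tree
lacks). This file shows that the bound form F1‡ `carlsonToledo1999_nodalMeridianLocalMonodromyBound` (`dim V ≤ p − 1`,
no non-vanishing: the bare localisation principle `(T − 1)H² ⊆ im j`, `T ∘ j = j ∘ h_*`) suffices, given the already
cited Betti number B2: if a nodal meridian acted trivially then, all meridian transports with that centre being conjugate
and generating `Γ`, the monodromy group would be trivial, every class `Γ`-invariant hence `τ`-fixed
(`carlsonToledo1999_monodromyInvariants_eq_deckInvariants_holds`), so `b₂(X_F) = dim H²(X_F)^σ = 1`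
(`carlsonToledo1999_finrank_eigenspace_deck_one_holds`) — against `b₂ = p³ − 4p² + 6p − 2`; and `V ⊇ (T − 1)H ≠ 0` is
then a `ℚ(ζ_p)`-line by the recognition theorem.

* (part I, `CyclicUnitaryPowersLocalMonodromyBoundReflection`: F1† ⇒ F1‡, `dim V^τ = 1`, per-meridian recognition)
* §3 `exists_cyclicReflectionSystem_of_localMonodromyBound`, `nonempty_carlsonToledoFamily_of_localMonodromyBound` —
  package and structure at primes `p ≥ 7` from F1‡ + B2;
* §4 **`veryGeneralDeckCommutatorsInHg_of_bound_facts (hF1 : F1‡) (hPG : PG) (hB2 : B2) (hCDK : CDK)`** + leaf twin.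

## References

* [CarlsonToledo1999] J. A. Carlson, D. Toledo, Duke Math. J. 97 (1999), §1, §2, §3, §6 (kdoublept) and Proposition, §7.
* [Shimada2010ZvK] I. Shimada, arXiv:0906.1074, §3 Prop. 3.4.
* [EisenbudHarris2016] D. Eisenbud, J. Harris, 3264 and All That, Ex. 5.24 / Table 5.1.
* [CattaniDeligneKaplan1995] E. Cattani, P. Deligne, A. Kaplan, J. Amer. Math. Soc. 8 (1995), Thm. 1.1, Cor. 1.2.
-/

noncomputable section

set_option linter.dupNamespace false

open CategoryTheory MvPolynomial _root_.Topology
open Literature.AlgebraicTopology.SingularHomology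
open Literature.AlgebraicGeometry.Motives Literature.AlgebraicGeometry.Motives.UniversalHypersurface
open Literature.AlgebraicGeometry.HodgeTheory Literature.AlgebraicGeometry.HodgeTheory.UniversalHypersurface
open Literature.AlgebraicGeometry.FundamentalGroup
open Summit.HodgeConjecture.HodgeConjecture.Theorems.SignSymmetricPowersMeridianMonodromy
open Summit.HodgeConjecture.HodgeConjecture.Theorems.CyclicUnitaryPowersPLPackageOfMeridians
open Summit.HodgeConjecture.HodgeConjecture.Theorems.CyclicUnitaryPowersNodalMeridianExists
open Summit.HodgeConjecture.HodgeConjecture.Theorems.CyclicUnitaryPowersMonodromyIsometry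
open Summit.HodgeConjecture.HodgeConjecture.Theorems.CyclicUnitaryPowersDeckModelClauses
open Summit.HodgeConjecture.HodgeConjecture.Theorems.CyclicUnitaryPowersLocalMonodromyReflection
open Summit.HodgeConjecture.HodgeConjecture.Theorems.CyclicUnitaryPowersPLPackageOfLocalMonodromy
open Summit.HodgeConjecture.HodgeConjecture.Theorems.CyclicUnitaryPowersK1OfPrintNumbers

open Summit.HodgeConjecture.HodgeConjecture.Theorems.CyclicUnitaryPowersLocalMonodromyBoundReflection

namespace Summit.HodgeConjecture.HodgeConjecture.Theorems.CyclicUnitaryPowersPLPackageOfLocalMonodromyBound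

/-! ### §3 The package and the structure at primes `p ≥ 7` from F1‡ and `b₂` -/

section Assembly

variable {p : ℕ} [NeZero p]

/-- **Bound-form local-monodromy fact + `b₂` → Picard–Lefschetz package at a prime `p ≥ 7`.** As in
`CyclicUnitaryPowersPLPackageOfNodalMeridian.carlsonToledo1999_cyclicReflectionSystem_of_nodalMeridian_facts`: the
generating set `𝓜` is the set of transports of the meridians centred at the explicit one-nodal ternary `p`-form
(`exists_meridian_center_uninodal`); they generate `Γ` (`closure_meridian_loopClasses_center_eq_top`, Zariski–van
Kampen), are pairwise conjugate (`affineHypersurfaceComplement_meridian_isConj_holds`), and for each of them the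
bound-form fact and §2 supply a power which is the cyclic reflection, the non-triviality `T ≠ 1` being global
(`T = 1` ⇒ `Γ = 1` ⇒ every class `τ`-fixed ⇒ `b₂ = 1`, against `EisenbudHarris2016_surface_secondBettiNumber`);
`nonempty_cyclicReflectionSystem_of_meridian_powers` assembles, the invariant-cycle clause being the tree theorem `carlsonToledo1999_monodromyInvariants_eq_deckInvariants_holds`.
CONDITIONAL on the one cited fact. [cite: CarlsonToledo1999, §2, §3, §6 (kdoublept) and Proposition, §7 last paragraph]
[cite: Shimada2010ZvK, §3 Prop. 3.4] -/
theorem exists_cyclicReflectionSystem_of_localMonodromyBound (H1 : carlsonToledo1999_nodalMeridianLocalMonodromyBound)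
    (hB2 : EisenbudHarris2016_surface_secondBettiNumber) (hp : p.Prime) (h7 : 7 ≤ p) {f : MvPolynomial (Fin 3) ℂ} (hf : f.IsHomogeneous p) (hf0 : f ≠ 0)
    (hX : IsSmoothProjective 2 (SmoothHypersurface.hypersurface (cyclicCoverForm p f))) :
    ∃ (e : fiberOver (cyclicCoverFamily p) (cyclicCoverPoint p f) ≅
          SmoothHypersurface.hypersurface (cyclicCoverForm p f))
      (τ : bettiCohomology (fiberOver (cyclicCoverFamily p) (cyclicCoverPoint p f)) 2 ≃ₗ[ℚ]
        bettiCohomology (fiberOver (cyclicCoverFamily p) (cyclicCoverPoint p f)) 2),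
      (∀ (ha : deckUnit p ∈ diagonalStabilizer (cyclicCoverForm p f))
          (x : bettiCohomology (fiberOver (cyclicCoverFamily p) (cyclicCoverPoint p f)) 2),
          BettiUniverse.pullEquiv e 2 (τ x) =
            BettiUniverse.pull (diagonalAut (cyclicCoverForm p f) ha) 2 (BettiUniverse.pullEquiv e 2 x)) ∧
      Nonempty (CyclicReflectionSystem
        (ratMonodromyGroup (cyclicCoverFamily p) 2 (cyclicCoverFamily_locallyTrivial p)
          ⟨cyclicCoverPoint p f, Set.mem_univ _⟩)
        (transportedTraceForm hX e 2) τ p) := by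
  have hodd : Odd p := hp.odd_of_ne_two (by omega)
  have h3 : 3 ≤ p := by omega
  have hp2 : 2 ≤ p := by omega
  have hp0 : p ≠ 0 := by omega
  have hJ := CyclicCoverFormNonsingular.isNonsingularForm_cyclicCoverForm_of_isSmoothProjective hp2 hf hf0 hX
  -- the identification and the covering automorphism
  obtain ⟨e, he⟩ := exists_isCompatibleFibreIso p hf hJ
  obtain ⟨τ, hτ⟩ := exists_deck_intertwining e
  refine ⟨e, τ, hτ, ?_⟩
  have hBs : (transportedTraceForm hX e 2).IsSymm := transportedTraceForm_isSymm hX e (by decide)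
  have hBnd : (transportedTraceForm hX e 2).Nondegenerate := transportedTraceForm_nondegenerate hX e
  have hBτ : ∀ x y, transportedTraceForm hX e 2 (τ x) (τ y) = transportedTraceForm hX e 2 x y :=
    transportedTraceForm_deck hX e hτ
  -- the coefficient chart of the base and an irreducible equation of the discriminant
  obtain ⟨D, hDirr, hDeq⟩ := exists_irreducible_discriminantEquation p hp2
  obtain ⟨χ, hχ⟩ := exists_homeomorph_affineHypersurfaceComplement p hDeq
  have hDeq' : IsDiscriminantEquation p D := hDeq
  have hχ' : IsCoefficientChart p D χ := hχ
  have hirr : ∀ j : Fin 1, Irreducible ((![D] : Fin 1 → MvPolynomial (TernaryIndex p) ℂ) j) := fun j => by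
    fin_cases j; exact hDirr
  -- base points and the pointed homeomorphism `Set.univ ≃ₜ {D ≠ 0}`
  let s₀ : ComplexPoints (cyclicCoverBase p) := cyclicCoverPoint p f
  let u₀ : (Set.univ : Set (ComplexPoints (cyclicCoverBase p))) := ⟨s₀, Set.mem_univ _⟩
  let Ψ : (Set.univ : Set (ComplexPoints (cyclicCoverBase p))) ≃ₜ affineHypersurfaceComplement ![D] :=
    (Homeomorph.Set.univ _).trans χ
  have hΨ : Ψ.symm (χ s₀) = u₀ := by
    rw [Homeomorph.symm_apply_eq]
    rfl
  let φ := FundamentalGroup.mapOfEq (Ψ.symm : C(affineHypersurfaceComplement ![D],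
    (Set.univ : Set (ComplexPoints (cyclicCoverBase p))))) hΨ
  have hφsurj : Function.Surjective φ := mapOfEq_surjective_of_homeomorph Ψ.symm hΨ
  -- the monodromy representation on `π₁(Set.univ, u₀)`
  obtain ⟨ρ, hρ, hrange⟩ := exists_monodromyHom (cyclicCoverFamily p) 2 (cyclicCoverFamily_locallyTrivial p)
    (isRationalClass_transportFun_cyclicCoverFamily) u₀
  -- ONE meridian centred at a one-nodal branch curve (the degeneration (kdoublept), CHOSEN)
  obtain ⟨μ₀, x₀, hnod₀⟩ := exists_meridian_center_uninodal h3 hDirr hDeq' (χ s₀)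
  -- reading a meridian loop back in `S(ℂ)`
  have hread : ∀ μ : Meridian ![D] (χ s₀) 0, ∃ γ : Path s₀ s₀, (∀ θ, χ (γ θ) = μ.loop θ) ∧
      FundamentalGroup.toPath (φ μ.loopClass) = cyclicCoverLoopClass p γ := by
    intro μ
    have hx : s₀ = χ.symm (χ s₀) := (χ.symm_apply_apply s₀).symm
    refine ⟨(μ.loop.map χ.symm.continuous).cast hx hx, fun θ => ?_, ?_⟩
    · change χ (χ.symm (μ.loop θ)) = μ.loop θ
      exact χ.apply_symm_apply _
    · dsimp only [φ]
      erw [Meridian.loopClass_def, mapOfEq_fromPath_mk]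
      change Path.Homotopic.Quotient.mk _ = Path.Homotopic.Quotient.mk _
      congr 1
  -- the set of meridian transports
  let 𝓜 : Set (bettiCohomology (fiberOver (cyclicCoverFamily p) (cyclicCoverPoint p f)) 2 ≃ₗ[ℚ]
      bettiCohomology (fiberOver (cyclicCoverFamily p) (cyclicCoverPoint p f)) 2) :=
    {g | ∃ μ : Meridian ![D] (χ s₀) 0, μ.y = μ₀.y ∧ g = ρ (φ μ.loopClass)}
  have hρmem : ∀ c, ρ c ∈ ratMonodromyGroup (cyclicCoverFamily p) 2 (cyclicCoverFamily_locallyTrivial p) u₀ :=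
    fun c => hrange ▸ ⟨c, rfl⟩
  haveI : Module.Finite ℚ (bettiCohomology (fiberOver (cyclicCoverFamily p) (cyclicCoverPoint p f)) 2) :=
    BettiUniverse.finite ((isSmoothProjectiveFamily_cyclicCoverFamily p).isSmoothProjective (cyclicCoverPoint p f)) 2
  have hgen' : ratMonodromyGroup (cyclicCoverFamily p) 2 (cyclicCoverFamily_locallyTrivial p) u₀ ≤
      Subgroup.closure 𝓜 := by
    -- Zariski–van Kampen from `μ₀` through `φ` and `ρ` (conjugates keep the centre)
    have hclos := closure_meridian_loopClasses_center_eq_top hDirr μ₀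
    have hclos' : Subgroup.closure (φ '' {c | ∃ μ : Meridian ![D] (χ s₀) 0, μ.y = μ₀.y ∧ c = μ.loopClass}) = ⊤ := by
      rw [← MonoidHom.map_closure, hclos, ← MonoidHom.range_eq_map, MonoidHom.range_eq_top.mpr hφsurj]
    intro g hg
    rw [← hrange] at hg
    obtain ⟨c, rfl⟩ := hg
    have hc : c ∈ Subgroup.closure (φ '' {c | ∃ μ : Meridian ![D] (χ s₀) 0, μ.y = μ₀.y ∧ c = μ.loopClass}) := by
      rw [hclos']; exact Subgroup.mem_top c
    have hmap : ρ c ∈ (Subgroup.closure (φ '' {c | ∃ μ : Meridian ![D] (χ s₀) 0,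
        μ.y = μ₀.y ∧ c = μ.loopClass})).map ρ :=
      Subgroup.mem_map_of_mem ρ hc
    rw [MonoidHom.map_closure] at hmap
    refine (Subgroup.closure_le _).mpr ?_ hmap
    rintro _ ⟨_, ⟨_, ⟨μ, hμy, rfl⟩, rfl⟩, rfl⟩
    exact Subgroup.subset_closure ⟨μ, hμy, rfl⟩
  have hconj' : ∀ T ∈ 𝓜, ∀ T' ∈ 𝓜, ∃ g ∈ ratMonodromyGroup (cyclicCoverFamily p) 2
      (cyclicCoverFamily_locallyTrivial p) u₀, T' = g * T * g⁻¹ := by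
    -- meridian conjugacy
    rintro T ⟨μ₁, -, rfl⟩ T' ⟨μ₂, -, rfl⟩
    have hconj := affineHypersurfaceComplement_meridian_isConj_holds (TernaryIndex p) 1 ![D] hirr (χ s₀) 0 μ₁ μ₂
    obtain ⟨c, hc⟩ := isConj_iff.mp hconj
    refine ⟨ρ (φ c), hρmem _, ?_⟩
    rw [← hc, map_mul, map_mul, map_inv, map_mul, map_mul, map_inv]
  -- no meridian transport is trivial: else `Γ = 1`, all classes are `τ`-fixed, `b₂ = 1` — but `b₂ = p³ − 4p² + 6p − 2`
  have hb2 : Module.finrank ℚ (bettiCohomology (fiberOver (cyclicCoverFamily p) (cyclicCoverPoint p f)) 2) =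
      p ^ 3 + 6 * p - (4 * p ^ 2 + 2) := by
    rw [LinearEquiv.finrank_eq (BettiUniverse.pullEquiv e 2)]
    exact hB2 (by omega) (cyclicCoverForm p f)
      (CyclicCoverFormNonsingular.isHomogeneous_cyclicCoverForm_of_isHomogeneous hf) hJ hX
  have hne : ∀ μ : Meridian ![D] (χ s₀) 0, μ.y = μ₀.y → ρ (φ μ.loopClass) ≠ 1 := by
    intro μ hμy h1
    -- every generator is conjugate to `1`, so `Γ = ⊥`
    have h𝓜 : ∀ g ∈ 𝓜, g = 1 := by
      rintro g hg
      obtain ⟨c, -, hc⟩ := hconj' _ ⟨μ, hμy, rfl⟩ g hg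
      rw [hc, h1, mul_one, mul_inv_cancel]
    have hΓ : ∀ g ∈ ratMonodromyGroup (cyclicCoverFamily p) 2 (cyclicCoverFamily_locallyTrivial p) u₀, g = 1 := by
      intro g hg
      have hg' := hgen' hg
      rw [(Subgroup.closure_eq_bot_iff).mpr (fun g hg => h𝓜 g hg), Subgroup.mem_bot] at hg'
      exact hg'
    -- all classes are `τ`-fixed
    have hτ1 : ∀ x : bettiCohomology (fiberOver (cyclicCoverFamily p) (cyclicCoverPoint p f)) 2, τ x = x :=
      fun x => carlsonToledo1999_monodromyInvariants_eq_deckInvariants_holds hodd h3 f hf hf0 hX e he τ hτ x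
        fun g hg => by rw [hΓ g hg]; rfl
    have htop : Module.End.eigenspace (τ : bettiCohomology (fiberOver (cyclicCoverFamily p) (cyclicCoverPoint p f)) 2 →ₗ[ℚ]
        bettiCohomology (fiberOver (cyclicCoverFamily p) (cyclicCoverPoint p f)) 2) 1 = ⊤ := by
      refine Submodule.eq_top_iff'.mpr fun x => ?_
      rw [Module.End.mem_eigenspace_iff, one_smul]
      exact hτ1 x
    have h := finrank_eigenspace_deck_one_fibre h3 hf hf0 hX e τ hτ
    rw [htop, finrank_top, hb2] at h
    have h4 : 4 * p ^ 2 ≤ p ^ 3 := by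
      calc 4 * p ^ 2 ≤ p * p ^ 2 := Nat.mul_le_mul_right _ (by omega)
        _ = p ^ 3 := by ring
    omega
  -- the transports of the meridians centred at `μ₀.y`: a power is the cyclic reflection (H1 and §2)
  have hmer : ∀ μ : Meridian ![D] (χ s₀) 0, μ.y = μ₀.y →
      ∃ (r : bettiCohomology (fiberOver (cyclicCoverFamily p) (cyclicCoverPoint p f)) 2 ≃ₗ[ℚ]
          bettiCohomology (fiberOver (cyclicCoverFamily p) (cyclicCoverPoint p f)) 2)
        (δ : bettiCohomology (fiberOver (cyclicCoverFamily p) (cyclicCoverPoint p f)) 2),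
        r ∈ ratMonodromyGroup (cyclicCoverFamily p) 2 (cyclicCoverFamily_locallyTrivial p) u₀ ∧
        ρ (φ μ.loopClass) ∈ Subgroup.zpowers r ∧
        δ ≠ 0 ∧ (∑ i ∈ Finset.range p, (τ ^ i) δ) = 0 ∧ Module.finrank ℚ (cyclicSpan τ δ) = p - 1 ∧
        (∀ x ∈ cyclicSpan τ δ, (∀ y ∈ cyclicSpan τ δ, transportedTraceForm hX e 2 x y = 0) → x = 0) ∧
        IsCyclicReflection (transportedTraceForm hX e 2) τ δ r ∧
        LinearMap.range ((ρ (φ μ.loopClass) : _ →ₗ[ℚ] _) - LinearMap.id) = cyclicSpan τ δ := by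
    intro μ hμy
    obtain ⟨γ, hγ, hcls⟩ := hread μ
    have hμ : ∃ x : Fin 3 → ℂ, IsNodalFormWithNodes (n := 1)
        (∑ e : TernaryIndex p, MvPolynomial.monomial e.1 (μ.y e)) ![x] := ⟨x₀, by rw [hμy]; exact hnod₀⟩
    obtain ⟨T, W, hT, hrangeW, hsumW, hdimW⟩ := H1 hodd h3 f hf hf0 hX D hDirr hDeq' χ hχ' μ hμ γ hγ
    have hTρ : ρ (φ μ.loopClass) = T := by
      refine isRatTransport_unique (cyclicCoverFamily p) 2 (cyclicCoverFamily_locallyTrivial p) (hρ _) ?_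
      rw [hcls]
      exact hT
    have hW0 : W ≠ ⊥ := by
      intro hW
      refine hne μ hμy (hTρ.trans (LinearEquiv.ext fun x => ?_))
      have hx : T x - x ∈ W := hrangeW x
      rw [hW, Submodule.mem_bot, sub_eq_zero] at hx
      exact hx
    rw [hTρ]
    exact exists_reflection_power_of_localMonodromyBound hp h3 hf hf0 hX e he τ hτ hT hrangeW hsumW hdimW hW0
  refine nonempty_cyclicReflectionSystem_of_meridian_powers hBs hBnd hBτ hp0 (𝓜 := 𝓜) hgen' hconj' ?_ ?_
  · -- the local Picard–Lefschetz content (H1 + recognition)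
    rintro T ⟨μ, hμy, rfl⟩
    exact hmer μ hμy
  · -- monodromy invariants are `τ`-invariant (tree theorem)
    exact fun x hx => carlsonToledo1999_monodromyInvariants_eq_deckInvariants_holds hodd h3 f hf hf0 hX e he τ hτ x hx

/-- **The Carlson–Toledo structure at every prime `p ≥ 7` from the bound-form local-monodromy fact and `b₂`** (the construction half is
the tree's `cyclicCoverFamily`, as in `carlsonToledoFamilyOfSystem`). CONDITIONAL on the one cited fact.
[cite: CarlsonToledo1999, §2, §3, §6 (kdoublept) and Proposition, §7 last paragraph] -/
theorem nonempty_carlsonToledoFamily_of_localMonodromyBound (H1 : carlsonToledo1999_nodalMeridianLocalMonodromyBound)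
    (hB2 : EisenbudHarris2016_surface_secondBettiNumber) (hp : p.Prime) (h7 : 7 ≤ p) :
    Nonempty (CarlsonToledoFamily p) := by
  have hp2 : 2 ≤ p := by omega
  have h := fun (f : MvPolynomial (Fin 3) ℂ) (hf : f.IsHomogeneous p) (hf0 : f ≠ 0)
    (hX : IsSmoothProjective 2 (SmoothHypersurface.hypersurface (cyclicCoverForm p f))) =>
    exists_cyclicReflectionSystem_of_localMonodromyBound H1 hB2 hp h7 hf hf0 hX
  exact ⟨{
    Y := cyclicCoverTotal p
    S := cyclicCoverBase p
    u := cyclicCoverFamily p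
    isSmoothProjectiveFamily := isSmoothProjectiveFamily_cyclicCoverFamily p
    isQuasiProjectiveOver := isQuasiProjectiveOver_baseSpz 2 p (cyclicCoverSpz p)
    isQuasiProjectiveOver_total :=
      isQuasiProjectiveOver_totalSpz 2 p (cyclicCoverSpz p) (cyclicCoverSpz_surjective p (NeZero.ne p))
    smooth := smooth_baseSpz_hom ℂ 2 p (cyclicCoverSpz p)
    irreducibleSpace := irreducibleSpace_cyclicCoverBase p
    locallyTrivial := cyclicCoverFamily_locallyTrivial p
    pt := cyclicCoverPoint p
    exists_polynomials := cyclicCoverPoint_exists_polynomials p hp2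
    pt_surjective := cyclicCoverPoint_surjective p hp2
    iso := fun f hf hf0 hX => (h f hf hf0 hX).choose
    deck := fun f hf hf0 hX => (h f hf hf0 hX).choose_spec.choose
    pullEquiv_deck := fun f hf hf0 hX ha x => (h f hf hf0 hX).choose_spec.choose_spec.1 ha x
    system := fun f hf hf0 hX => ((h f hf hf0 hX).choose_spec.choose_spec.2).some }⟩

end Assembly

/-! ### §4 Crux K1 and the rung leaf from the bound-form fact -/

section Crux

/-- **Crux K1 `VeryGeneralDeckCommutatorsInHg` modulo FOUR cited facts with the WEAKEST Picard–Lefschetz input**: F1‡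
(`carlsonToledo1999_nodalMeridianLocalMonodromyBound`: `(T − 1)H² ⊆ V`, `Σ_{i<p} T^i|_V = 0`, `dim V ≤ p − 1` — the bare
localisation principle for the `A_{p−1}` degeneration), PG, B2 (Betti number, also used for `T ≠ 1`), CDK; through the
junction `CyclicUnitaryPowersK1OfPrintNumbers.veryGeneralDeckCommutatorsInHg_of_prime_family_printNumbers` (prover-Bx). CONDITIONAL; nothing here says
HC ∕ HC_AV is proved. [cite: CarlsonToledo1999, §2, §5, §6 (kdoublept), §7 Theorem 7.1] [cite: CattaniDeligneKaplan1995, Thm. 1.1 and Cor. 1.2] -/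
theorem veryGeneralDeckCommutatorsInHg_of_bound_facts
    (hF1 : carlsonToledo1999_nodalMeridianLocalMonodromyBound)
    (hPG : Arapura2012_hypersurface_geometricGenus)
    (hB2 : EisenbudHarris2016_surface_secondBettiNumber)
    (hCDK : cmsp_nonHodgeGenericPoints_countable_algebraic_cover) :
    Summit.HodgeConjecture.HodgeConjecture.Theses.CyclicUnitaryPowers.VeryGeneralDeckCommutatorsInHg :=
  veryGeneralDeckCommutatorsInHg_of_prime_family_printNumbers
    (fun _ hp h7 => haveI : NeZero _ := ⟨hp.ne_zero⟩
      nonempty_carlsonToledoFamily_of_localMonodromyBound hF1 @hB2 hp h7) @hPG @hB2 @hCDK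

/-- **The rung leaf `CyclicSurfacePowersHodge` (stmt-HodgeConjecture-19543) from the same four facts.** CONDITIONAL;
rung F-H1 not moved. [cite: CarlsonToledo1999, §2, §5, §6 (kdoublept), §7 Theorem 7.1] [cite: CattaniDeligneKaplan1995, Thm. 1.1 and Cor. 1.2] -/
theorem cyclicSurfacePowersHodge_of_bound_facts
    (hF1 : carlsonToledo1999_nodalMeridianLocalMonodromyBound)
    (hPG : Arapura2012_hypersurface_geometricGenus)
    (hB2 : EisenbudHarris2016_surface_secondBettiNumber)
    (hCDK : cmsp_nonHodgeGenericPoints_countable_algebraic_cover) :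
    Summit.HodgeConjecture.HodgeConjecture.Theses.CyclicUnitaryPowers.CyclicSurfacePowersHodge :=
  CyclicUnitaryPowersCyclicSurfacePowersHodge.cyclicSurfacePowersHodge_of_veryGeneralDeckCommutatorsInHg
    (veryGeneralDeckCommutatorsInHg_of_bound_facts @hF1 @hPG @hB2 @hCDK)

end Crux

end Summit.HodgeConjecture.HodgeConjecture.Theorems.CyclicUnitaryPowersPLPackageOfLocalMonodromyBound

end
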